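import Summits.QuantumFields.QCD.Theorems.QuarksAsStableActionCriticalLineDiamagnetismCellFirstOrderDefs
import Summits.QuantumFields.QCD.Theorems.QuarksAsStableActionCriticalLineDiamagnetismCellSecondOrderAux1
import Mathlib.Analysis.CStarAlgebra.Matrix

/-!
# The free 2D frequency operator in Kronecker form: shifts, hop norm, invertibility (B6 `cellFirstOrder` infrastructure, 1/4)

Crux `Summit.QuantumFields.QCD.Theses.QuarksAsStableAction.CriticalLineDiamagnetism` (item stmt-QuantumFields-9734,
sub-problem `Summits/QuantumFields/QCD/Statement.lean`), line `Sketch`, Route B step B6: infrastructure for the registered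
cell sub-stub `cellFirstOrder` of `stub_heavyFrequencyGain` (plan `S4-PLAN.md` §B6 of the line lead; vocabulary
`CellFO.*` of `…CellFirstOrderDefs`).

The FREE rectangular frequency operator `freeOp L₁ L₂ m ω₀ ω₁ = freqOpR γ 1 m ω₀ ω₁` on `ℤ/L₁ × ℤ/L₂` is
`1 ⊗ 1 ⊗ N_ω − hopOp` (`free_eq_kron`) with `N_ω = CellWalk.spinN M_ω (sin ω₀) (sin ω₁)` and the colour-carrying hopping
operator `hopOp = S⁺ ⊗ 1 ⊗ P₋² + S⁻ ⊗ 1 ⊗ P₊² + U⁺ ⊗ 1 ⊗ P₋³ + U⁻ ⊗ 1 ⊗ P₊³`.  This file: the Kronecker form, the algebra of the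
seam-signed shifts (`S⁺S⁻ = S⁻S⁺ = 1`, `(S⁺)ᴴ = S⁻`), the unitarity of each hopping direction and `‖hopOp‖ ≤ 2`, then (with
the on-site inverse `CellKappa.nInv` and the Wilson-projection / on-site identities of the sibling file `…CellSecondOrderAux1`,
namespace `CellWalk`) `‖1 ⊗ 1 ⊗ N⁻¹‖ ≤ 1/M`, `‖N⁻¹H‖ ≤ 2/M`, the factorisation `D = (1 ⊗ 1 ⊗ N)(1 − N⁻¹H)`, the
invertibility of the free operator for `M_ω > 2`, the resolvent identity `D⁻¹ = N⁻¹ + N⁻¹ H D⁻¹` and `‖D⁻¹‖ ≤ 1/(M_ω − 2)`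
(L² operator norms).
-/

noncomputable section

open scoped BigOperators Matrix ComplexConjugate Kronecker Matrix.Norms.L2Operator
open Matrix Literature.MathematicalPhysics.QuantumLattice
open Summit.QuantumFields.QCD.Cruxes.CriticalLineDiamagnetism.ChessboardCellGain.FrequencyDiamagnetism
open Summit.QuantumFields.QCD.Cruxes.CriticalLineDiamagnetism.ChessboardCellGain.CellKappa

namespace Summit.QuantumFields.QCD.Cruxes.CriticalLineDiamagnetism.ChessboardCellGain.CellFO

variable {L₁ L₂ : ℕ}


/-- Entries of `1 ⊗ 1 ⊗ S`. -/
theorem one_kron_one_kron_apply (S : Matrix (Fin 4) (Fin 4) ℂ) (x y : ZMod L₁ × ZMod L₂) (c c' : Fin 3)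
    (i j : Fin 4) :
    ((1 : Matrix (ZMod L₁ × ZMod L₂) (ZMod L₁ × ZMod L₂) ℂ) ⊗ₖ ((1 : Matrix (Fin 3) (Fin 3) ℂ) ⊗ₖ S))
      (x, c, i) (y, c', j) = if x = y ∧ c = c' then S i j else 0 := by
  simp only [Matrix.kroneckerMap_apply, Matrix.one_apply, ite_and, ite_mul, one_mul, zero_mul]

/-- **Kronecker form of the free operator**: `D_free = 1 ⊗ 1 ⊗ N_ω − H`. -/
theorem free_eq_kron (m ω₀ ω₁ : ℝ) :
    freeOp L₁ L₂ m ω₀ ω₁ = (1 : Matrix (ZMod L₁ × ZMod L₂) (ZMod L₁ × ZMod L₂) ℂ) ⊗ₖ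
      ((1 : Matrix (Fin 3) (Fin 3) ℂ) ⊗ₖ CellWalk.spinN (m + 4 - Real.cos ω₀ - Real.cos ω₁) (Real.sin ω₀) (Real.sin ω₁)) - hopOp L₁ L₂ := by
  ext ⟨x, c, i⟩ ⟨y, c', j⟩
  rw [Matrix.sub_apply, one_kron_one_kron_apply]
  simp only [freeOp, hopOp, sfShift, sbShift, ufShift, ubShift, CellWalk.spinN, freqOpR, Matrix.of_apply,
    Matrix.add_apply, Matrix.sub_apply, Matrix.kroneckerMap_apply, Matrix.smul_apply, smul_eq_mul, pMinus, pPlus,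
    OneMemClass.coe_one, star_one]
  split_ifs <;> ring

/-! ### Algebra of the seam-signed shifts -/

/-- A seam sign squares to one. -/
theorem sign_mul_self (P : Prop) [Decidable P] : (if P then (-1 : ℂ) else 1) * (if P then (-1 : ℂ) else 1) = 1 := by
  split_ifs <;> norm_num

/-- A seam sign is real. -/
theorem star_sign (P : Prop) [Decidable P] : star (if P then (-1 : ℂ) else 1) = (if P then (-1 : ℂ) else 1) := by
  split_ifs <;> simp

/-- `(S⁺)ᴴ = S⁻`. -/
theorem Sf_conjTranspose : (sfShift L₁ L₂)ᴴ = sbShift L₁ L₂ := by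
  ext x y
  simp only [sfShift, sbShift, Matrix.conjTranspose_apply, Matrix.of_apply]
  split_ifs <;> simp

/-- `(S⁻)ᴴ = S⁺`. -/
theorem Sb_conjTranspose : (sbShift L₁ L₂)ᴴ = sfShift L₁ L₂ := by
  rw [← Sf_conjTranspose, Matrix.conjTranspose_conjTranspose]

/-- `(U⁺)ᴴ = U⁻`. -/
theorem Uf_conjTranspose : (ufShift L₁ L₂)ᴴ = ubShift L₁ L₂ := by
  ext x y
  simp only [ufShift, ubShift, Matrix.conjTranspose_apply, Matrix.of_apply]
  split_ifs <;> simp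

/-- `(U⁻)ᴴ = U⁺`. -/
theorem Ub_conjTranspose : (ubShift L₁ L₂)ᴴ = ufShift L₁ L₂ := by
  rw [← Uf_conjTranspose, Matrix.conjTranspose_conjTranspose]

variable [NeZero L₁] [NeZero L₂]

/-- `S⁺ S⁻ = 1`. -/
theorem Sf_mul_Sb : sfShift L₁ L₂ * sbShift L₁ L₂ = 1 := by
  ext x z
  simp only [sfShift, sbShift, Matrix.mul_apply, Matrix.of_apply, ite_zero_mul, Finset.sum_ite_eq', Finset.mem_univ, if_true,
    Matrix.one_apply]
  by_cases hxz : x = z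
  · subst hxz
    rw [if_pos rfl, if_pos rfl, sign_mul_self]
  · have h : ¬ ((x.1 + 1, x.2) : ZMod L₁ × ZMod L₂) = (z.1 + 1, z.2) := by
      intro h
      exact hxz (Prod.ext (by simpa using congrArg Prod.fst h) (by simpa using congrArg Prod.snd h))
    simp [h, hxz]

/-- `S⁻ S⁺ = 1`. -/
theorem Sb_mul_Sf : sbShift L₁ L₂ * sfShift L₁ L₂ = 1 := by
  ext x z
  have hiff : ∀ y : ZMod L₁ × ZMod L₂, x = (y.1 + 1, y.2) ↔ y = (x.1 - 1, x.2) := fun y =>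
    ⟨fun h => by subst h; simp, fun h => by subst h; simp⟩
  simp only [sfShift, sbShift, Matrix.mul_apply, Matrix.of_apply, hiff, ite_zero_mul, Finset.sum_ite_eq',
    Finset.mem_univ, if_true, Matrix.one_apply, sub_add_cancel, Prod.mk.eta]
  by_cases hxz : z = x
  · subst hxz
    rw [if_pos rfl, if_pos rfl, sign_mul_self]
  · simp [hxz, Ne.symm hxz]

/-- `U⁺ U⁻ = 1`. -/
theorem Uf_mul_Ub : ufShift L₁ L₂ * ubShift L₁ L₂ = 1 := by
  ext x z
  simp only [ufShift, ubShift, Matrix.mul_apply, Matrix.of_apply, ite_zero_mul, Finset.sum_ite_eq', Finset.mem_univ, if_true,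
    Matrix.one_apply]
  by_cases hxz : x = z
  · subst hxz
    rw [if_pos rfl, if_pos rfl, sign_mul_self]
  · have h : ¬ ((x.1, x.2 + 1) : ZMod L₁ × ZMod L₂) = (z.1, z.2 + 1) := by
      intro h
      exact hxz (Prod.ext (by simpa using congrArg Prod.fst h) (by simpa using congrArg Prod.snd h))
    simp [h, hxz]

/-- `U⁻ U⁺ = 1`. -/
theorem Ub_mul_Uf : ubShift L₁ L₂ * ufShift L₁ L₂ = 1 := by
  ext x z
  have hiff : ∀ y : ZMod L₁ × ZMod L₂, x = (y.1, y.2 + 1) ↔ y = (x.1, x.2 - 1) := fun y =>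
    ⟨fun h => by subst h; simp, fun h => by subst h; simp⟩
  simp only [ufShift, ubShift, Matrix.mul_apply, Matrix.of_apply, hiff, ite_zero_mul, Finset.sum_ite_eq',
    Finset.mem_univ, if_true, Matrix.one_apply, sub_add_cancel, Prod.mk.eta]
  by_cases hxz : z = x
  · subst hxz
    rw [if_pos rfl, if_pos rfl, sign_mul_self]
  · simp [hxz, Ne.symm hxz]

/-! ### Unitarity of one hopping direction -/

/-- **Each hopping direction is unitary**: for seam-signed shifts `X`, `Y = Xᴴ` with `XY = YX = 1`, the operator
`X ⊗ 1 ⊗ P₋ + Y ⊗ 1 ⊗ P₊` is an isometry. -/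
theorem hopDir_isometry {T : Type} [Fintype T] [DecidableEq T] (X Y : Matrix T T ℂ) (hX : Xᴴ = Y) (hY : Yᴴ = X)
    (hXY : X * Y = 1) (hYX : Y * X = 1) (μ : Fin 4) :
    (X ⊗ₖ ((1 : Matrix (Fin 3) (Fin 3) ℂ) ⊗ₖ pMinus μ) + Y ⊗ₖ ((1 : Matrix (Fin 3) (Fin 3) ℂ) ⊗ₖ pPlus μ))ᴴ *
      (X ⊗ₖ ((1 : Matrix (Fin 3) (Fin 3) ℂ) ⊗ₖ pMinus μ) + Y ⊗ₖ ((1 : Matrix (Fin 3) (Fin 3) ℂ) ⊗ₖ pPlus μ)) = 1 := by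
  rw [Matrix.conjTranspose_add, Matrix.conjTranspose_kronecker, Matrix.conjTranspose_kronecker,
    Matrix.conjTranspose_kronecker, Matrix.conjTranspose_kronecker, hX, hY, Matrix.conjTranspose_one,
    CellWalk.conjTranspose_pMinus, CellWalk.conjTranspose_pPlus, Matrix.add_mul, Matrix.mul_add, Matrix.mul_add,
    ← Matrix.mul_kronecker_mul, ← Matrix.mul_kronecker_mul, ← Matrix.mul_kronecker_mul, ← Matrix.mul_kronecker_mul,
    ← Matrix.mul_kronecker_mul, ← Matrix.mul_kronecker_mul, ← Matrix.mul_kronecker_mul, ← Matrix.mul_kronecker_mul,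
    Matrix.one_mul, hXY, hYX, CellWalk.pMinus_mul_pMinus, CellWalk.pMinus_mul_pPlus, CellWalk.pPlus_mul_pMinus,
    CellWalk.pPlus_mul_pPlus,
    Matrix.kronecker_zero, Matrix.kronecker_zero, Matrix.kronecker_zero, add_zero, zero_add, ← Matrix.kronecker_add,
    ← Matrix.kronecker_add, CellWalk.pMinus_add_pPlus, Matrix.one_kronecker_one, Matrix.one_kronecker_one]

/-! ### Operator norms -/

/-- An isometry has operator norm at most one. -/
theorem norm_le_one_of_isometry {T : Type} [Fintype T] [DecidableEq T] (H : Matrix T T ℂ) (h : Hᴴ * H = 1) :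
    ‖H‖ ≤ 1 := by
  have h2 : ‖H‖ * ‖H‖ ≤ 1 := by
    rw [← Matrix.l2_opNorm_conjTranspose_mul_self, h, Matrix.cstar_norm_def, map_one]
    exact ContinuousLinearMap.norm_id_le
  nlinarith [norm_nonneg H]

/-- **`‖H‖ ≤ 2`** for the free hopping operator. -/
theorem norm_hop_le : ‖hopOp L₁ L₂‖ ≤ 2 := by
  rw [hopOp, add_assoc]
  refine (norm_add_le _ _).trans ?_
  have h2 := norm_le_one_of_isometry _ (hopDir_isometry (sfShift L₁ L₂) (sbShift L₁ L₂) Sf_conjTranspose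
    Sb_conjTranspose Sf_mul_Sb Sb_mul_Sf 2)
  have h3 := norm_le_one_of_isometry _ (hopDir_isometry (ufShift L₁ L₂) (ubShift L₁ L₂) Uf_conjTranspose
    Ub_conjTranspose Uf_mul_Ub Ub_mul_Uf 3)
  linarith

/-! ### The on-site spin block (complements `CellWalk`) -/

omit [NeZero L₁] [NeZero L₂] in
/-- `N_ωᴴ = N̄_ω = M·1 − i(s₀γ₀ + s₁γ₁)`. -/
theorem nM_conjTranspose (M s₀ s₁ : ℝ) :
    (CellWalk.spinN M s₀ s₁)ᴴ =
      (((M : ℝ) : ℂ)) • (1 : Matrix (Fin 4) (Fin 4) ℂ) -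
        Complex.I • ((((s₀ : ℝ) : ℂ)) • euclideanGamma 0 + ((s₁ : ℝ) : ℂ) • euclideanGamma 1) := by
  simp only [CellWalk.spinN, Matrix.conjTranspose_add, Matrix.conjTranspose_smul, Matrix.conjTranspose_one,
    (euclideanGamma_isHermitian 0).eq, (euclideanGamma_isHermitian 1).eq, Complex.star_def, Complex.conj_ofReal,
    Complex.conj_I, neg_smul, sub_eq_add_neg]

omit [NeZero L₁] [NeZero L₂] in
/-- `ρ² > 0` for `M > 0`. -/
theorem rhoSq_pos {M : ℝ} (hM : 0 < M) (s₀ s₁ : ℝ) : 0 < M ^ 2 + s₀ ^ 2 + s₁ ^ 2 := by positivity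

omit [NeZero L₁] [NeZero L₂] in
/-- `(N_ω⁻¹)ᴴ N_ω⁻¹ = ρ⁻²·1`. -/
theorem nInv_conjTranspose_mul_nInv {M : ℝ} (hM : 0 < M) (s₀ s₁ : ℝ) :
    (nInv M s₀ s₁)ᴴ * nInv M s₀ s₁ = (((1 / (M ^ 2 + s₀ ^ 2 + s₁ ^ 2) : ℝ)) : ℂ) • (1 : Matrix (Fin 4) (Fin 4) ℂ) := by
  rw [CellWalk.conjTranspose_nInv, Matrix.smul_mul, CellWalk.spinN_mul_nInv M s₀ s₁ (rhoSq_pos hM s₀ s₁).ne']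

/-! ### Norm of the inverse on-site operator, invertibility of the free operator -/

omit [NeZero L₁] [NeZero L₂] in
/-- `‖1 ⊗ 1 ⊗ N_ω⁻¹‖ ≤ 1/M`. -/
theorem norm_nni_le {T : Type} [Fintype T] [DecidableEq T] {M : ℝ} (hM : 0 < M) (s₀ s₁ : ℝ) :
    ‖(1 : Matrix T T ℂ) ⊗ₖ ((1 : Matrix (Fin 3) (Fin 3) ℂ) ⊗ₖ nInv M s₀ s₁)‖ ≤ 1 / M := by
  set A := (1 : Matrix T T ℂ) ⊗ₖ ((1 : Matrix (Fin 3) (Fin 3) ℂ) ⊗ₖ nInv M s₀ s₁)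
  have hρ := rhoSq_pos hM s₀ s₁
  have hsq : ‖A‖ * ‖A‖ ≤ 1 / M * (1 / M) := by
    have h1 : Aᴴ * A = (((1 / (M ^ 2 + s₀ ^ 2 + s₁ ^ 2) : ℝ)) : ℂ) •
        (1 : Matrix (T × Fin 3 × Fin 4) (T × Fin 3 × Fin 4) ℂ) := by
      simp only [A]
      rw [Matrix.conjTranspose_kronecker, Matrix.conjTranspose_kronecker, Matrix.conjTranspose_one,
        Matrix.conjTranspose_one, ← Matrix.mul_kronecker_mul, ← Matrix.mul_kronecker_mul, Matrix.one_mul,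
        Matrix.one_mul, nInv_conjTranspose_mul_nInv hM, Matrix.kronecker_smul, Matrix.kronecker_smul,
        Matrix.one_kronecker_one, Matrix.one_kronecker_one]
    rw [← Matrix.l2_opNorm_conjTranspose_mul_self, h1, norm_smul, Complex.norm_real, Real.norm_eq_abs,
      abs_of_pos (by positivity), Matrix.cstar_norm_def, map_one]
    calc 1 / (M ^ 2 + s₀ ^ 2 + s₁ ^ 2) * ‖ContinuousLinearMap.id ℂ (EuclideanSpace ℂ (T × Fin 3 × Fin 4))‖
        ≤ 1 / (M ^ 2 + s₀ ^ 2 + s₁ ^ 2) * 1 :=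
          mul_le_mul_of_nonneg_left ContinuousLinearMap.norm_id_le (by positivity)
      _ ≤ 1 / M * (1 / M) := by
          rw [mul_one, one_div_mul_one_div]
          exact one_div_le_one_div_of_le (by positivity) (by nlinarith [sq_nonneg s₀, sq_nonneg s₁])
  exact (mul_self_le_mul_self_iff (norm_nonneg A) (by positivity)).mpr hsq

/-- `‖N⁻¹ H‖ ≤ 2/M`. -/
theorem norm_K_le {m ω₀ ω₁ : ℝ} (hM : 0 < m + 4 - Real.cos ω₀ - Real.cos ω₁) :
    ‖(1 : Matrix (ZMod L₁ × ZMod L₂) (ZMod L₁ × ZMod L₂) ℂ) ⊗ₖ ((1 : Matrix (Fin 3) (Fin 3) ℂ) ⊗ₖ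
        nInv (m + 4 - Real.cos ω₀ - Real.cos ω₁) (Real.sin ω₀) (Real.sin ω₁)) * hopOp L₁ L₂‖ ≤
      2 / (m + 4 - Real.cos ω₀ - Real.cos ω₁) := by
  refine (Matrix.l2_opNorm_mul _ _).trans ?_
  rw [div_eq_mul_one_div, mul_comm (2 : ℝ)]
  exact mul_le_mul (norm_nni_le hM _ _) norm_hop_le (norm_nonneg _) (by positivity)

/-- `(1 ⊗ 1 ⊗ N)(1 ⊗ 1 ⊗ N⁻¹) = 1`. -/
theorem nn_mul_nni {m ω₀ ω₁ : ℝ} (hM : 0 < m + 4 - Real.cos ω₀ - Real.cos ω₁) :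
    ((1 : Matrix (ZMod L₁ × ZMod L₂) (ZMod L₁ × ZMod L₂) ℂ) ⊗ₖ ((1 : Matrix (Fin 3) (Fin 3) ℂ) ⊗ₖ CellWalk.spinN (m + 4 - Real.cos ω₀ - Real.cos ω₁) (Real.sin ω₀) (Real.sin ω₁))) *
      ((1 : Matrix (ZMod L₁ × ZMod L₂) (ZMod L₁ × ZMod L₂) ℂ) ⊗ₖ ((1 : Matrix (Fin 3) (Fin 3) ℂ) ⊗ₖ
        nInv (m + 4 - Real.cos ω₀ - Real.cos ω₁) (Real.sin ω₀) (Real.sin ω₁))) = 1 := by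
  rw [← Matrix.mul_kronecker_mul, ← Matrix.mul_kronecker_mul, Matrix.one_mul, Matrix.one_mul,
    CellWalk.spinN_mul_nInv _ _ _ (rhoSq_pos hM _ _).ne', Matrix.one_kronecker_one, Matrix.one_kronecker_one]

/-- `(1 ⊗ 1 ⊗ N⁻¹)(1 ⊗ 1 ⊗ N) = 1`. -/
theorem nni_mul_nn {m ω₀ ω₁ : ℝ} (hM : 0 < m + 4 - Real.cos ω₀ - Real.cos ω₁) :
    ((1 : Matrix (ZMod L₁ × ZMod L₂) (ZMod L₁ × ZMod L₂) ℂ) ⊗ₖ ((1 : Matrix (Fin 3) (Fin 3) ℂ) ⊗ₖ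
        nInv (m + 4 - Real.cos ω₀ - Real.cos ω₁) (Real.sin ω₀) (Real.sin ω₁))) *
      ((1 : Matrix (ZMod L₁ × ZMod L₂) (ZMod L₁ × ZMod L₂) ℂ) ⊗ₖ ((1 : Matrix (Fin 3) (Fin 3) ℂ) ⊗ₖ CellWalk.spinN (m + 4 - Real.cos ω₀ - Real.cos ω₁) (Real.sin ω₀) (Real.sin ω₁))) =
      1 := by
  rw [← Matrix.mul_kronecker_mul, ← Matrix.mul_kronecker_mul, Matrix.one_mul, Matrix.one_mul,
    CellWalk.nInv_mul_spinN _ _ _ (rhoSq_pos hM _ _).ne', Matrix.one_kronecker_one, Matrix.one_kronecker_one]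

/-- The free operator factors as `D = (1 ⊗ 1 ⊗ N)(1 − N⁻¹H)`. -/
theorem free_eq_factor {m ω₀ ω₁ : ℝ} (hM : 0 < m + 4 - Real.cos ω₀ - Real.cos ω₁) :
    freeOp L₁ L₂ m ω₀ ω₁ =
      ((1 : Matrix (ZMod L₁ × ZMod L₂) (ZMod L₁ × ZMod L₂) ℂ) ⊗ₖ ((1 : Matrix (Fin 3) (Fin 3) ℂ) ⊗ₖ CellWalk.spinN (m + 4 - Real.cos ω₀ - Real.cos ω₁) (Real.sin ω₀) (Real.sin ω₁))) *
      (1 - (1 : Matrix (ZMod L₁ × ZMod L₂) (ZMod L₁ × ZMod L₂) ℂ) ⊗ₖ ((1 : Matrix (Fin 3) (Fin 3) ℂ) ⊗ₖ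
        nInv (m + 4 - Real.cos ω₀ - Real.cos ω₁) (Real.sin ω₀) (Real.sin ω₁)) * hopOp L₁ L₂) := by
  rw [Matrix.mul_sub, Matrix.mul_one, ← Matrix.mul_assoc, nn_mul_nni hM, Matrix.one_mul, free_eq_kron]

/-- **The free operator is invertible for `M_ω > 2`.** -/
theorem free_isUnit_det {m ω₀ ω₁ : ℝ} (hM : 2 < m + 4 - Real.cos ω₀ - Real.cos ω₁) :
    IsUnit (freeOp L₁ L₂ m ω₀ ω₁).det := by
  have hM0 : 0 < m + 4 - Real.cos ω₀ - Real.cos ω₁ := by linarith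
  rw [← Matrix.isUnit_iff_isUnit_det, free_eq_factor hM0]
  refine IsUnit.mul ⟨⟨_, _, nn_mul_nni hM0, nni_mul_nn hM0⟩, rfl⟩
    (isUnit_one_sub_of_norm_lt_one ((norm_K_le hM0).trans_lt ?_))
  rw [div_lt_one hM0]
  exact hM

/-- **One-step resolvent identity**: `D⁻¹ = N⁻¹ + N⁻¹ H D⁻¹` (with `N⁻¹ = 1 ⊗ 1 ⊗ N_ω⁻¹`). -/
theorem free_inv_eq {m ω₀ ω₁ : ℝ} (hM : 2 < m + 4 - Real.cos ω₀ - Real.cos ω₁) :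
    (freeOp L₁ L₂ m ω₀ ω₁)⁻¹ =
      (1 : Matrix (ZMod L₁ × ZMod L₂) (ZMod L₁ × ZMod L₂) ℂ) ⊗ₖ ((1 : Matrix (Fin 3) (Fin 3) ℂ) ⊗ₖ
        nInv (m + 4 - Real.cos ω₀ - Real.cos ω₁) (Real.sin ω₀) (Real.sin ω₁)) +
      (1 : Matrix (ZMod L₁ × ZMod L₂) (ZMod L₁ × ZMod L₂) ℂ) ⊗ₖ ((1 : Matrix (Fin 3) (Fin 3) ℂ) ⊗ₖ
        nInv (m + 4 - Real.cos ω₀ - Real.cos ω₁) (Real.sin ω₀) (Real.sin ω₁)) * hopOp L₁ L₂ *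
        (freeOp L₁ L₂ m ω₀ ω₁)⁻¹ := by
  have hM0 : 0 < m + 4 - Real.cos ω₀ - Real.cos ω₁ := by linarith
  have h1 : freeOp L₁ L₂ m ω₀ ω₁ * (freeOp L₁ L₂ m ω₀ ω₁)⁻¹ = 1 := Matrix.mul_nonsing_inv _ (free_isUnit_det hM)
  nth_rw 1 [free_eq_kron] at h1
  rw [Matrix.sub_mul, sub_eq_iff_eq_add] at h1
  have h3 := congrArg (· * (freeOp L₁ L₂ m ω₀ ω₁)⁻¹) (nni_mul_nn (L₁ := L₁) (L₂ := L₂) hM0)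
  simp only [] at h3
  rw [Matrix.mul_assoc, h1, Matrix.one_mul, Matrix.mul_add, Matrix.mul_one] at h3
  rw [Matrix.mul_assoc]
  exact h3.symm

/-- **A-priori bound** `‖D⁻¹‖ ≤ 1/(M_ω − 2)`. -/
theorem norm_free_inv_le {m ω₀ ω₁ : ℝ} (hM : 2 < m + 4 - Real.cos ω₀ - Real.cos ω₁) :
    ‖(freeOp L₁ L₂ m ω₀ ω₁)⁻¹‖ ≤ 1 / (m + 4 - Real.cos ω₀ - Real.cos ω₁ - 2) := by
  have hM0 : 0 < m + 4 - Real.cos ω₀ - Real.cos ω₁ := by linarith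
  have hn : ‖(freeOp L₁ L₂ m ω₀ ω₁)⁻¹‖ ≤ 1 / (m + 4 - Real.cos ω₀ - Real.cos ω₁) +
      2 / (m + 4 - Real.cos ω₀ - Real.cos ω₁) * ‖(freeOp L₁ L₂ m ω₀ ω₁)⁻¹‖ := by
    have h := free_inv_eq (L₁ := L₁) (L₂ := L₂) hM
    calc ‖(freeOp L₁ L₂ m ω₀ ω₁)⁻¹‖ = _ := congrArg _ h
      _ ≤ _ := norm_add_le _ _
      _ ≤ _ := add_le_add (norm_nni_le hM0 _ _)
          ((Matrix.l2_opNorm_mul _ _).trans (mul_le_mul_of_nonneg_right (norm_K_le hM0) (norm_nonneg _)))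
  generalize ‖(freeOp L₁ L₂ m ω₀ ω₁)⁻¹‖ = g at hn ⊢
  generalize m + 4 - Real.cos ω₀ - Real.cos ω₁ = M at hM hM0 hn ⊢
  rw [le_div_iff₀ (by linarith), mul_sub]
  have h3 : 2 / M * g * M = 2 * g := by field_simp
  have h4 : 1 / M * M = 1 := by field_simp
  nlinarith [mul_le_mul_of_nonneg_right hn hM0.le]


end CellFO

/-- The free operator is invertible for `M_ω > 2` with `‖D⁻¹‖ ≤ 1/(M_ω − 2)` (L² operator norm). -/
theorem cellFreeInvBound : ∀ (L₁ L₂ : ℕ) [NeZero L₁] [NeZero L₂] (m ω₀ ω₁ : ℝ), 2 < m + 4 - Real.cos ω₀ - Real.cos ω₁ → IsUnit (CellFO.freeOp L₁ L₂ m ω₀ ω₁).det ∧ ‖(CellFO.freeOp L₁ L₂ m ω₀ ω₁)⁻¹‖ ≤ 1 / (m + 4 - Real.cos ω₀ - Real.cos ω₁ - 2) :=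
  fun _ _ _ _ _ _ _ hM => ⟨CellFO.free_isUnit_det hM, CellFO.norm_free_inv_le hM⟩

/-- **Registered anchor `cellFreeShiftUnitary`**: the seam-signed (antiperiodic) forward shift of the first coordinate times the backward one is the identity. -/
theorem cellFreeShiftUnitary : ∀ (L₁ L₂ : ℕ) [NeZero L₁] [NeZero L₂], (Matrix.of fun x y : ZMod L₁ × ZMod L₂ => if y = (x.1 + 1, x.2) then (if x.1 = -1 then (-1 : ℂ) else 1) else 0) * (Matrix.of fun x y : ZMod L₁ × ZMod L₂ => if x = (y.1 + 1, y.2) then (if y.1 = -1 then (-1 : ℂ) else 1) else 0) = 1 :=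
  fun _ _ _ _ => CellFO.Sf_mul_Sb

end Summit.QuantumFields.QCD.Cruxes.CriticalLineDiamagnetism.ChessboardCellGain

end
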